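import Summits.HodgeConjecture.HodgeConjecture.Theorems.Ring2AbelianAllNonsplitNormObstruction
import Summits.HodgeConjecture.HodgeConjecture.Theorems.Ring2AbelianAllWeilFieldCM
import HarnessLib

/-!
# No isometric graph in the non-split cell: `ᵗḡ · diag(1,1,2) · g = 1` has no solution over `ℚ(√-3)`
  (WEIL-2 gen 21, door (h), DOOR-FULL-G21 §3)

research route, not a corollary; conditional on HC_CM plus one named minimal statement.

Cell `pub-hodge-ring2-ab-*` (ALL ABELIAN VARIETIES), seat WEIL-2 gen 21, account
`run/shared/lean/pub/pub-hodge-ring2/pub-hodge-ring2-ab-weil-2/DOOR-FULL-G21.md` §3.  At Deligne's product anchor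
`Y₀ = E_ω³ × Ē_ω³` of the non-split `(ℚ(√-3), (3,3))` Weil component (`NonsplitSixfolds[ℚ(√-3), -2]`, polarisation
type `(1,1,1,1,1,2)`), the Weil-carrying components of a linear cluster are graphs `Γ_g = {(x, g x)}` of `K`-linear
isomorphisms `g : V₁ → V₂` between the two `ι`-eigenspaces, which carry the Hermitian forms `h₁ = diag(1,1,1)` and
`h₂ = diag(1,1,2)` of the polarisation.  DOOR-FULL-G21 §3 shows that the OBSTRUCTION RANK of `Γ_g` (the number of
independent first-order obstructions to moving `Γ_g` along the 9 Weil directions, hence a lower bound for the number of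
gluing partners `Γ_g` needs in any RM⁺-full cluster) is `9 - dim ker(1 + M_g)` with `M_g² = N_g ⊗ N_g'`, `N_g` the matrix
of `g^* h₂` relative to `h₁`; it attains its minimum `3` exactly when `N_g = 1`, i.e. when `g` is an ISOMETRY
`(V₁, h₁) ≅ (V₂, h₂)`.  This file proves that no such isometry exists — the determinant of `ᵗḡ h₂ g = h₁` would give
`2 · Nm(det g) = 1`, i.e. `Nm(2 det g) = 2`, against `2 ∉ Nm(ℚ(√-3)ˣ)` (gen 17, `norm_ne_two`) — so every graph component in
the cell has obstruction rank `≥ 6` (loc. cit.), whereas in the split sibling (`h₂ = 1`) isometric graphs such as `Γ_1`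
have rank `3`.  Pure field/matrix arithmetic; no abelian variety, no named fact, `HC_CM` absent; no case of the Hodge
conjecture is claimed.

## What is proved (0 sorry)

* `det_map_transpose_mul_mul` — `det(ᵗσ(g) Ψ g) = det Ψ · (det g · σ(det g))` for any ring endomorphism `σ`.
* `norm_ne_half` — no element of `K₃ = ℚ(√-3)` has norm `1/2`.
* `det_diag112`, `not_exists_isometry_diag112` — `¬ ∃ g ∈ M₃(K₃), ᵗḡ · diag(1,1,2) · g = 1` (no `def`: the form is written out).
* `det_eq_det_mul_norm_of_isometry` — `ᵗσ(g) Ψ₂ g = Ψ₁ ⟹ det Ψ₁ = det Ψ₂ · (det g · σ(det g))`;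
  `not_exists_isometry_diag112'` — the opposite normalisation `ᵗḡ g = diag(1,1,2)` is impossible as well.

## References

* [vanGeemen1994HodgeAV] B. van Geemen, An introduction to the Hodge conjecture for abelian varieties, LNM 1594 (1994),
  4.14, Lemma 5.2 (3), (5.4.1) (discriminant of a Hermitian form is a class in `ℚˣ/Nm Kˣ`).
* [Landherr1936HermitianForms] W. Landherr, Abh. Math. Sem. Hamburg 11 (1936) 245–248 (isometry classes of Hermitian
  forms over CM fields: dimension, discriminant class, signatures) — context.
-/

noncomputable section

open Polynomial NumberField
open Literature.AlgebraicGeometry.VanGeemen1994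
open Summit.HodgeConjecture.HodgeConjecture.Ring2.AbelianAll

namespace Summit.HodgeConjecture.Ring2AbelianAll.NonsplitNoIsometricGraph

/-- **`det(ᵗσ(g) · Ψ · g) = det Ψ · (det g · σ(det g))`** for a ring endomorphism `σ` (here: complex conjugation of a
CM field), the determinant identity behind "the discriminant class of a Hermitian form is well defined modulo norms".
research route, not a corollary; conditional on HC_CM plus one named minimal statement. [folklore] -/
theorem det_map_transpose_mul_mul {R : Type*} [CommRing R] {k : ℕ} (σ : R →+* R) (Ψ g : Matrix (Fin k) (Fin k) R) :
    (g.transpose.map σ * Ψ * g).det = Ψ.det * (g.det * σ g.det) := by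
  rw [Matrix.det_mul, Matrix.det_mul, ← RingHom.mapMatrix_apply, ← RingHom.map_det, Matrix.det_transpose]
  ring

/-- **A Hermitian isometry scales the determinant by a norm**: if `ᵗσ(g) Ψ₂ g = Ψ₁` then
`det Ψ₁ = det Ψ₂ · (det g · σ(det g))`.
research route, not a corollary; conditional on HC_CM plus one named minimal statement. [cite: vanGeemen1994HodgeAV, Lemma 5.2 (3)] -/
theorem det_eq_det_mul_norm_of_isometry {R : Type*} [CommRing R] {k : ℕ} (σ : R →+* R)
    {Ψ₁ Ψ₂ g : Matrix (Fin k) (Fin k) R} (h : g.transpose.map σ * Ψ₂ * g = Ψ₁) :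
    Ψ₁.det = Ψ₂.det * (g.det * σ g.det) := by
  rw [← h, det_map_transpose_mul_mul]

section K3

variable [Fact (Irreducible (X ^ 2 + C ((3 : ℕ) : ℚ) : ℚ[X]))]

/-- **No element of `K₃ = ℚ(√-3)` has norm `1/2`** (else `2z` would have norm `4 · ½ = 2`, against `norm_ne_two`).
research route, not a corollary; conditional on HC_CM plus one named minimal statement. [cite: vanGeemen1994HodgeAV, 4.14] -/
theorem norm_ne_half (z : weilField 3) : Algebra.norm ℚ z ≠ 1 / 2 := by
  intro hz
  have h2 : Algebra.norm ℚ (algebraMap ℚ (weilField 3) 2 * z) = 2 := by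
    rw [map_mul, Algebra.norm_algebraMap, finrank_weilField, hz]
    norm_num
  exact NonsplitNormObstruction.norm_ne_two _ h2

/-- `det diag(1,1,2) = 2` — `diag(1,1,2)` is the Hermitian form `h₂` of the `ῑ`-eigenspace `V₂` at the anchor `E_ω³ × Ē_ω³`
with polarisation type `(1,1,1,1,1,2)` (and `h₁ = diag(1,1,1) = 1` on `V₁`).
research route, not a corollary; conditional on HC_CM plus one named minimal statement. [folklore] -/
theorem det_diag112 :
    (Matrix.diagonal ![1, 1, algebraMap ℚ (weilField 3) 2] : Matrix (Fin 3) (Fin 3) (weilField 3)).det =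
      algebraMap ℚ (weilField 3) 2 := by
  rw [Matrix.det_diagonal, Fin.prod_univ_three]
  simp

variable [IsCMField (weilField 3)]

/-- **No isometric graph in the non-split cell.**  There is no `g ∈ M₃(ℚ(√-3))` with `ᵗḡ · diag(1,1,2) · g = 1`, i.e. the
Hermitian spaces `(K₃³, diag(1,1,1))` and `(K₃³, diag(1,1,2))` are not isometric: their discriminants `1` and `2` differ
in `ℚˣ/Nm(K₃ˣ)`.  Consequence (DOOR-FULL-G21 §3): every graph component `Γ_g` of a linear cluster at `E_ω³ × Ē_ω³` in the
non-split cell has obstruction rank `≥ 6` along the Weil directions (rank `3` would require `g` to be such an isometry).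
research route, not a corollary; conditional on HC_CM plus one named minimal statement. [cite: vanGeemen1994HodgeAV, (5.4.1)] -/
theorem not_exists_isometry_diag112 :
    ¬ ∃ g : Matrix (Fin 3) (Fin 3) (weilField 3),
      g.transpose.map (IsCMField.complexConj (weilField 3) : weilField 3 →+* weilField 3) *
        Matrix.diagonal ![1, 1, algebraMap ℚ (weilField 3) 2] * g = 1 := by
  rintro ⟨g, hg⟩
  have hdet := det_eq_det_mul_norm_of_isometry (IsCMField.complexConj (weilField 3) : weilField 3 →+* weilField 3) hg
  rw [Matrix.det_one, det_diag112, RingHom.coe_coe, mul_complexConj_eq_algebraMap_norm, ← map_mul] at hdet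
  -- `1 = algebraMap (2 * Nm(det g))`, so `Nm(det g) = 1/2`
  have h1 : (2 : ℚ) * Algebra.norm ℚ g.det = 1 := by
    have := (algebraMap ℚ (weilField 3)).injective (a₁ := 2 * Algebra.norm ℚ g.det) (a₂ := 1) (by rw [← hdet, map_one])
    exact this
  exact norm_ne_half g.det (by linarith)

/-- The same for the OPPOSITE normalisation `ᵗḡ · 1 · g = diag(1,1,2)` (an isometry `(V₂, h₂) ≅ (V₁, h₁)`): impossible,
since then `2 = Nm(det g)`.
research route, not a corollary; conditional on HC_CM plus one named minimal statement. [cite: vanGeemen1994HodgeAV, (5.4.1)] -/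
theorem not_exists_isometry_diag112' :
    ¬ ∃ g : Matrix (Fin 3) (Fin 3) (weilField 3),
      g.transpose.map (IsCMField.complexConj (weilField 3) : weilField 3 →+* weilField 3) * 1 * g =
        Matrix.diagonal ![1, 1, algebraMap ℚ (weilField 3) 2] := by
  rintro ⟨g, hg⟩
  have hdet := det_eq_det_mul_norm_of_isometry (IsCMField.complexConj (weilField 3) : weilField 3 →+* weilField 3) hg
  rw [Matrix.det_one, det_diag112, RingHom.coe_coe, mul_complexConj_eq_algebraMap_norm, one_mul] at hdet
  have h2 : Algebra.norm ℚ g.det = 2 := ((algebraMap ℚ (weilField 3)).injective hdet).symm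
  exact NonsplitNormObstruction.norm_ne_two _ h2

end K3

end Summit.HodgeConjecture.Ring2AbelianAll.NonsplitNoIsometricGraph

end
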